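import Literature.NumberTheory.Automorphic.ParabolicGLBigCell
import Literature.NumberTheory.Automorphic.JacquetLemma
import HarnessLib

/-!
# The Iwahori datum of a standard parabolic of `GL_n(F)` and Jacquet's first lemma for `r_c`

For a monotone block labelling `c : Fin n → Fin r` we construct
`Literature.NumberTheory.Automorphic.iwahoriDatumGL F hc hϖ0 hϖ1 : (parabolicTripleGL F c).IwahoriDatum`
(`JacquetModule`): `N̄ = U_c⁻`, the contracting block-scalar element `a = diag(ϖ^{-c(i)})`, the
principal congruence subgroups `K j = K_{|ϖ|^{j+1}}` with their **Iwahori factorisation**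
`K = (K ∩ U_c⁻)(K ∩ M_c)(K ∩ U_c)` (from the two-factor factorisation
`exists_parabolic_mul_lower_of_mem_congruenceGL` of `ParabolicGLBigCell` and the block-diagonal part
of an element of `P_c ∩ K`), and the contraction `a^{-i}(K ∩ U_c⁻)a^{i} ⊆ K_j`
(`exists_conj_lower_mem_congruenceGL`). Consequently **Jacquet's first lemma** holds for the
`GL_n` Jacquet functor (`fixedPoints_jacquetGL_le_map`): for an admissible `π`, every vector of
`r_c(π) = jacquetGL F c π` fixed by the Levi level `K^L_j = {k : diag k ∈ K_j}` is the class of a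
`K_j`-fixed vector of `π` (Casselman 1995, Thm. 3.3.3; Bernstein–Zelevinsky 1976, 3.16 (a)).
One definition (the datum), theorems otherwise; no named facts.

## References

* W. Casselman, *Introduction to the theory of admissible representations of `p`-adic reductive
  groups* (1995 draft), Prop. 1.4.4, Thm. 3.3.3.
* I. N. Bernstein, A. V. Zelevinsky, Russian Math. Surveys 31:3 (1976), 3.13–3.16.
-/

noncomputable section

open scoped MatrixGroups Pointwise
open ValuativeRel

namespace Literature.NumberTheory.Automorphic

open Representation

section Datum

variable (F : Type*) [Field F] [ValuativeRel F] [TopologicalSpace F] [IsNonarchimedeanLocalField F]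
  {n r : ℕ} {c : Fin n → Fin r}

omit [ValuativeRel F] [TopologicalSpace F] [IsNonarchimedeanLocalField F] in
/-- Entries of the block-diagonal part `diag(proj p)` of `p ∈ P_c`: `p i j` on the diagonal
blocks, `0` elsewhere. [folklore] -/
theorem blockDiagonalGL_leviProjection_apply (p : standardParabolicGL F c) (i j : Fin n) :
    ((blockDiagonalGL F c (leviProjection F c p) : GL (Fin n) F) : Matrix (Fin n) (Fin n) F) i j =
      if c i = c j then ((p : GL (Fin n) F) : Matrix (Fin n) (Fin n) F) i j else 0 := by
  rw [blockDiagonalGL_apply_coe]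
  split_ifs with h
  · have : (⟨c j, ⟨j, rfl⟩⟩ : Σ a, {l // c l = a}) = ⟨c i, ⟨j, h.symm⟩⟩ := Sigma.subtype_ext h.symm rfl
    rw [this, Matrix.blockDiagonal'_apply_eq, leviProjection_apply_coe]
  · rw [Matrix.blockDiagonal'_apply_ne]
    exact h

omit [TopologicalSpace F] [IsNonarchimedeanLocalField F] in
/-- The block-diagonal part of an element of `P_c ∩ K_γ` lies in `K_γ`. [folklore] -/
theorem blockDiagonalGL_leviProjection_mem_congruenceGL {γ : ValueGroupWithZero F} (hγ : γ ≤ 1)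
    (p : standardParabolicGL F c) (hp : (p : GL (Fin n) F) ∈ congruenceGL n γ) :
    blockDiagonalGL F c (leviProjection F c p) ∈ congruenceGL n γ := by
  -- the bound on `m - 1` for `m = diag(proj q)`, `q ∈ P_c ∩ K_γ`
  have hsub : ∀ q : standardParabolicGL F c, (q : GL (Fin n) F) ∈ congruenceGL n γ →
      ValBound γ (((blockDiagonalGL F c (leviProjection F c q) : GL (Fin n) F) : Matrix (Fin n) (Fin n) F) - 1) := by
    intro q hq i j
    rw [Matrix.sub_apply, blockDiagonalGL_leviProjection_apply]
    split_ifs with h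
    · have := hq.2.1 i j
      rwa [Matrix.sub_apply] at this
    · have hij : i ≠ j := fun hij => h (hij ▸ rfl)
      rw [Matrix.one_apply_ne hij, sub_zero, map_zero]
      exact zero_le
  have h1 := hsub p hp
  have h2 := hsub p⁻¹ (Subgroup.inv_mem _ hp)
  rw [map_inv, map_inv] at h2
  exact ⟨⟨h1.of_sub_one hγ, h2.of_sub_one hγ⟩, h1, h2⟩

omit [ValuativeRel F] [TopologicalSpace F] [IsNonarchimedeanLocalField F] in
/-- A block-scalar `diag(ϖ^e)` (`e` constant on blocks) commutes with the standard Levi. [folklore] -/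
theorem zpowDiagGL_comm_of_mem_standardLeviGL {ϖ : F} (hϖ : ϖ ≠ 0) {e : Fin n → ℤ}
    (he : ∀ i j, c i = c j → e i = e j) {m : GL (Fin n) F} (hm : m ∈ standardLeviGL F c) :
    m * zpowDiagGL hϖ e = zpowDiagGL hϖ e * m := by
  obtain ⟨l, rfl⟩ := hm
  rw [leviEmbedding_apply, ← blockDiagonalGL_leviZpowDiag c hϖ, ← map_mul, ← map_mul,
    (Subgroup.mem_center_iff.1 (leviZpowDiag_mem_center c hϖ he) l)]

omit [ValuativeRel F] [TopologicalSpace F] [IsNonarchimedeanLocalField F] in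
/-- Powers of `diag(ϖ^e)`: `diag(ϖ^e)^g = diag(ϖ^{g e})`. [folklore] -/
theorem zpowDiagGL_pow {ϖ : F} (hϖ : ϖ ≠ 0) (e : Fin n → ℤ) (g : ℕ) :
    zpowDiagGL hϖ e ^ g = zpowDiagGL hϖ (fun i => (g : ℤ) * e i) := by
  induction g with
  | zero =>
    rw [pow_zero]
    have : (fun i : Fin n => ((0 : ℕ) : ℤ) * e i) = 0 := funext fun i => by simp
    rw [this, zpowDiagGL_zero]
  | succ g ih =>
    rw [pow_succ, ih, ← zpowDiagGL_add]
    congr 1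
    funext i
    simp only [Pi.add_apply, Nat.cast_succ]
    ring

variable {F}

/-- **The Iwahori datum of the standard parabolic `P_c` of `GL_n(F)`** (`c` monotone,
`0 < |ϖ| < 1`): `N̄ = U_c⁻`, `a = diag(ϖ^{-c(i)})`, `K j = K_{|ϖ|^{j+1}}` with the Iwahori
factorisation `K = (K ∩ U_c⁻)(K ∩ M_c)(K ∩ U_c)` and `a^{-i}(K ∩ U_c⁻)a^{i} → 1`.
(Casselman 1995, Prop. 1.4.4; Bernstein–Zelevinsky 1976, 3.13.) [cite: Casselman1995, Prop. 1.4.4] -/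
def iwahoriDatumGL (hc : Monotone c) {ϖ : F} (hϖ0 : valuation F ϖ ≠ 0) (hϖ1 : valuation F ϖ < 1) :
    (parabolicTripleGL F c).IwahoriDatum where
  Nbar := unipotentRadicalGL F (⇑OrderDual.toDual ∘ c)
  a := zpowDiagGL ((Valuation.ne_zero_iff _).1 hϖ0) (fun i => -((c i : ℕ) : ℤ))
  a_mem := zpowDiagGL_mem_standardLeviGL c _ _
  a_comm := fun m hm => zpowDiagGL_comm_of_mem_standardLeviGL F _ (fun i j h => by rw [h]) hm
  K := fun j => congruenceGL n (valuation F ϖ ^ (j + 1))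
  isOpen_K := (bigCellDatumGL hc hϖ0 hϖ1).isOpen_K
  isCompact_K := (bigCellDatumGL hc hϖ0 hϖ1).isCompact_K
  hasBasis_K := (bigCellDatumGL hc hϖ0 hϖ1).exists_K_subset
  factorization := fun j => by
    have hγ1 : valuation F ϖ ^ (j + 1) < 1 := pow_lt_one₀ zero_le hϖ1 (Nat.succ_ne_zero j)
    apply le_antisymm
    · intro x hx
      -- `x⁻¹ = p u`, so `x = u⁻¹ p⁻¹ = u⁻¹ (m n)`
      obtain ⟨p, hpP, hpK, u, huU, huK, hxinv⟩ :=
        exists_parabolic_mul_lower_of_mem_congruenceGL c hγ1 (Subgroup.inv_mem _ hx)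
      have hx' : x = u⁻¹ * p⁻¹ := by rw [← _root_.mul_inv_rev, ← hxinv, inv_inv]
      set q : standardParabolicGL F c := ⟨p⁻¹, Subgroup.inv_mem _ hpP⟩ with hq
      set m : GL (Fin n) F := blockDiagonalGL F c (leviProjection F c q) with hm
      have hmK : m ∈ congruenceGL n (valuation F ϖ ^ (j + 1)) :=
        blockDiagonalGL_leviProjection_mem_congruenceGL F hγ1.le q (Subgroup.inv_mem _ hpK)
      have hmM : m ∈ standardLeviGL F c := ⟨_, rfl⟩
      have hnN : m⁻¹ * p⁻¹ ∈ unipotentRadicalGL F c := by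
        have : (⟨m, (standardLeviGL_le F c) hmM⟩ : standardParabolicGL F c)⁻¹ * q ∈ unipotentRadicalP F c := by
          rw [MonoidHom.mem_ker, map_mul, map_inv]
          have : leviProjection F c ⟨m, (standardLeviGL_le F c) hmM⟩ = leviProjection F c q := by
            rw [show (⟨m, (standardLeviGL_le F c) hmM⟩ : standardParabolicGL F c) =
              leviEmbeddingP F c (leviProjection F c q) from Subtype.ext rfl, leviProjection_leviEmbeddingP_apply]
          rw [this, inv_mul_cancel]
        rw [← unipotentRadicalGL_subgroupOf, Subgroup.mem_subgroupOf] at this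
        exact this
      refine Set.mem_mul.2 ⟨u⁻¹ * m, Set.mem_mul.2 ⟨u⁻¹, ⟨Subgroup.inv_mem _ huK, Subgroup.inv_mem _ huU⟩, m,
        ⟨hmK, hmM⟩, rfl⟩, m⁻¹ * p⁻¹, ⟨?_, hnN⟩, ?_⟩
      · exact Subgroup.mul_mem _ (Subgroup.inv_mem _ hmK) (Subgroup.inv_mem _ hpK)
      · rw [hx']; group
    · rintro _ ⟨_, ⟨a, ha, b, hb, rfl⟩, d, hd, rfl⟩
      exact Subgroup.mul_mem _ (Subgroup.mul_mem _ ha.1 hb.1) hd.1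
  exists_conj_inf_Nbar_le := fun j j' => by
    obtain ⟨g, hg⟩ := exists_conj_lower_mem_congruenceGL c ((Valuation.ne_zero_iff _).1 hϖ0) hϖ0 hϖ1 1
      (valuation F ϖ ^ (j + 1)) (δ := valuation F ϖ ^ (j' + 1)) (pow_ne_zero _ hϖ0) (pow_le_one₀ zero_le hϖ1.le)
    refine ⟨g, ?_⟩
    -- `(a^g)⁻¹ = diag(ϖ^{g c(i)})`
    have ha : (zpowDiagGL ((Valuation.ne_zero_iff _).1 hϖ0) (fun i => -((c i : ℕ) : ℤ)) ^ g)⁻¹ =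
        zpowDiagGL ((Valuation.ne_zero_iff _).1 hϖ0) (fun i => (g : ℤ) * (c i : ℕ)) := by
      rw [zpowDiagGL_pow, ← zpowDiagGL_neg]
      congr 1
      funext i
      simp only [Pi.neg_apply, mul_neg, neg_neg]
    rintro _ ⟨u, ⟨huK, huU⟩, rfl⟩
    rw [MulDistribMulAction.toMonoidEnd_apply, MulDistribMulAction.toMonoidHom_apply, ConjAct.smul_def,
      ConjAct.ofConjAct_toConjAct, ha]
    have := hg u huU huK
    rwa [one_mul] at this

/-- **Jacquet's first lemma for `r_c`** (surjectivity of `π^{K_j} → r_c(π)^{K^L_j}`): for an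
admissible `π` and the Levi level `K^L_j = {k : diag k ∈ K_j}`, every `K^L_j`-fixed vector of
`r_c(π) = jacquetGL F c π` is the class of a `K_j`-fixed vector of `π`
(`JacquetLemma.fixedPoints_jacquetModule_le_map` for `iwahoriDatumGL`, transported along
`jacquetGLEquiv`). (Casselman 1995, Thm. 3.3.3; Bernstein–Zelevinsky 1976, 3.16 (a).)
[cite: Casselman1995, Thm. 3.3.3] -/
theorem fixedPoints_jacquetGL_le_map (hc : Monotone c) {ϖ : F} (hϖ0 : valuation F ϖ ≠ 0) (hϖ1 : valuation F ϖ < 1)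
    {V : Type*} [AddCommGroup V] [Module ℂ V] (π : Representation ℂ (GL (Fin n) F) V) (hπ : π.IsAdmissible)
    (j : ℕ) :
    (jacquetGL F c π).fixedPoints ((congruenceGL n (valuation F ϖ ^ (j + 1))).comap (blockDiagonalGL F c)) ≤
      (π.fixedPoints (congruenceGL n (valuation F ϖ ^ (j + 1)))).map
        (Coinvariants.mk (restrictUnipotentGL F c π)) := by
  haveI : IsTopologicalRing F := inferInstance
  intro x hx
  obtain ⟨v, rfl⟩ := Coinvariants.mk_surjective _ x
  set t := parabolicTripleGL F c with ht
  set e := jacquetGLEquiv F c π with he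
  -- the class of `v` in the abstract Jacquet module is `K_j ∩ M`-fixed
  have hy : Coinvariants.mk (t.restrict π) v ∈
      (π.jacquetModule t).fixedPoints (((iwahoriDatumGL hc hϖ0 hϖ1).K j).comap t.M.subtype) := by
    rw [mem_fixedPoints]
    intro m hm
    obtain ⟨l, hl⟩ : ∃ l, leviEmbedding F c l = (m : GL (Fin n) F) := m.2
    have hml : m = (leviEmbedding F c).rangeRestrict l := Subtype.ext hl.symm
    have hlK : l ∈ (congruenceGL n (valuation F ϖ ^ (j + 1))).comap (blockDiagonalGL F c) := by
      rw [Subgroup.mem_comap, ← leviEmbedding_apply, hl]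
      exact hm
    have h1 := (mem_fixedPoints _ _ _).1 hx l hlK
    have h2 := e.toIntertwiningMap.isIntertwining _ _ l (Coinvariants.mk (restrictUnipotentGL F c π) v)
    rw [h1] at h2
    -- `h2 : e [v] = ((jacquetModule).comp rangeRestrict) l (e [v])`
    rw [hml]
    have h3 : e (Coinvariants.mk (restrictUnipotentGL F c π) v) = Coinvariants.mk (t.restrict π) v := rfl
    rw [← h3]
    exact h2.symm
  obtain ⟨w, hw, hwv⟩ := JacquetLemma.fixedPoints_jacquetModule_le_map π t (iwahoriDatumGL hc hϖ0 hϖ1) hπ j hy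
  refine ⟨w, hw, ?_⟩
  -- `[w] = [v]` in `r_c(π)` since it holds after `jacquetGLEquiv`
  apply EquivLike.injective e
  change Coinvariants.mk (t.restrict π) w = Coinvariants.mk (t.restrict π) v
  exact hwv

end Datum

end Literature.NumberTheory.Automorphic
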